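import Summits.QuantumFields.YangMills.Theorems.BalabanUVNodesN12FlatChartDerivIterLin
import Summits.QuantumFields.YangMills.Theorems.BalabanUVNodesN07CritTangentConverse
import Literature.MathematicalPhysics.QuantumFieldTheory.Balaban1983to89.Node00.WilsonActionSecondVariationNearFlat

/-!
# BalabanUVNodes ∕ N12 — (J-iii) at the chart level: THE DEVIATION OF `DΨ_U(0)` FROM THE `linAvg`-RECURSION `Q^{(j)}` IS LINEAR IN `‖↑U − 1‖` NEAR THE FLAT CONFIGURATION
# (the `(δ₂)` letter the N12 road U2c⁺ absorbs into `Cerr`: `‖(DΦ_U(0)X)_i − π((Q^{(j)}↑X)(c))‖ ≤ C·‖↑U − 1‖·‖↑X‖`, `C, ρ` chosen BEFORE `U`)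

Cell `pub-ymgap` (D-0062 ∕ D-0149), width seat `pub-ymgap-dag-n10-w1` g0; lane word dag-n12-c g16 (bus l.≈27120: «YES to the chart-level three-term combination … EXPLICITLY LINEAR in the
smallness δ (an ∃-constant in front is fine; hidden δ-dependence is not) … `C` depending on `L, k, d` only»).  Key K1⁷ `stmt-QuantumFields-20542`, `--kind proof --supports … --as helper`;
count-neutral; THEOREMS ONLY.  STANDALONE EDITION: §0 re-proves PRIVATELY (verbatim) the letters of this seat's module C `…N12GuardedChartDerivIterLin` (p596651 ✓), whose farm olean
was not built in time to be imported — cite module C's PUBLIC originals, never §0.  CONSUMED BY NAME: n07-e's 35b-i `Node00.AveragingSmooth` (`iterM`, `coeField`, `contDiffAt_iterM`,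
`coeField_avgFamily_eq_iterM`), 35e `…N07CritTangentConverse` (`hasDerivAt_coeField_iter`, `smallBelow_of_plaqSmall`), this seat's module B (`hasDerivAt_coe_iter_expChart_one_smul`),
n07-w2's `Node00.MultiScaleFibreChart` (`msChart`, `suProj`, `fderiv_msChart_apply_of_hasDerivAt`), Mathlib (`ContDiffAt.exists_lipschitzOnWith`, `norm_star`, `SemilinearMapClass.bound_of_continuous`).
THE PRINT.  [Balaban1985Averaging] Prop. 3 (121)–(125) p. 36 (linearised average = `L(Q(V₀)A)` + terms `O(L²α₀)`); [Balaban1985Variational] Sect. C (44)–(48) p. 285, (83) p. 290;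
[Balaban1987RG1] (0.4) p. 253, (0.21) p. 256.
CONTENTS.  §1 letters (`exists_norm_fderiv_iterM_sub_fderiv_one_le`, `exists_norm_fderiv_iterM_le`, the `↑U_b − 1` twist `norm_coeMul_sub_le`, the `W* − 1` twist = `Node00.norm_star_sub_one` of `WilsonActionSecondVariationNearFlat` (imported),
`exists_norm_suProj_le`, `exists_levelLetters[_uniform]` — ONE pair `K, ρ` for all levels `j ≤ k`).  §2 ★★ `exists_norm_leftTriv_fderiv_iterM_sub_iterLin_le` — GUARD-FREE, CHART-FREE core
estimate `‖(iterM j ↑U)(c)*·(D(Ū^j)(↑U)[b ↦ ↑U_b·↑X_b])(c) − (Q^{(j)}↑X)(c)‖ ≤ C·‖↑U − 1‖·‖↑X‖` (`j ≤ k`, `‖↑U − 1‖ < ρ`; the left entry is n07-w1's `qLin j U X c` by `rfl`) by the split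
`W*·a − q = (W* − 1)·a + (a − a′) + (a′ − q)`.  §3 ★★★ `exists_norm_fderiv_msChart_sub_suProj_iterLin_le` — the `(δ₂)` LETTER at NODE 00's chart (module C §3 + §2 through a bound of `π`),
★ `…_of_forall_norm_sub_one_le` — the lane word's shape on the bondwise guard `∀ b, ‖↑U_b − 1‖ ≤ δ < ρ`: `≤ C·δ·‖↑X‖`.
HONEST FRAMING.  Constants EXIST by smoothness near the flat configuration (C¹ ⇒ Lipschitz derivative on a ball) — print's explicit `O(L²α₀)` is NOT claimed; BOTH guards displayed
(`‖↑U − 1‖ < ρ` for the deviation, 35e's plaquette guard for the chart's differentiability); `π = suProj` enters through `‖π(v)‖ ≤ c‖v‖` (the operator-norm instance into the pinned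
`𝔰𝔲(N)` structures is not synthesizable, so no `‖π‖` is written).  Nothing of Bałaban's estimates asserted; N12 NOT discharged; count-neutral (typed 28∕28 · discharged 5∕27 unmoved);
one finite 𝕋⁴ programme at fixed ε — R4 closes the conditional rung `BalabanLadder.UV` only; the YM mass gap (Clay) is NOT proved by any of this.  No `sorry`∕`def`∕`instance`∕`notation`.
-/

noncomputable section

open scoped BigOperators Matrix.Norms.L2Operator Topology NNReal
open Filter Asymptotics Finset

namespace Summit.QuantumFields.YangMills.BalabanUVNodes.N12GuardedChartDerivDeviation

open Literature.MathematicalPhysics.QuantumFieldTheory.Balaban1983to89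
open T4Continuum (T4Family)
open BlockAveraging (blockAvg)
open ExpMeanLog (expMeanLogSU deltaSU deltaSU_pos)
open BlockAveragingEMLLinearised (linAvg)
open T4AdjointCovarianceUnitary (lieSU expSU)
open B15DeterminingSets
open Node00
open Summit.QuantumFields.YangMills.Theorems.BlockAvgCorrector (stokesConst stokesConst_nonneg)
open Summit.QuantumFields.YangMills.BalabanUVNodes.N07CritTangentConverse (hasDerivAt_coeField_iter smallBelow_of_plaqSmall)
open Summit.QuantumFields.YangMills.BalabanUVNodes.N12FlatChartDerivIterLin (hasDerivAt_coe_iter_expChart_one_smul hasDerivAt_coe_expChart_one_smul)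

/-! ## §1a  Generic letters (no torus structure needed) -/

section Generic

variable {P : Params} {N : ℕ}

/-- **The `↑U_b − 1` twist** (generic): `‖(b ↦ A_b·X_b) − X‖ ≤ ‖A − 1‖·‖X‖` in the sup norms (bondwise `(A_b − 1)·X_b` and `norm_mul_le`). [folklore] -/
theorem norm_mulLeft_sub_le {ι : Type*} [Fintype ι] (A X : ι → Matrix (Fin N) (Fin N) ℂ) : ‖(fun b => A b * X b) - X‖ ≤ ‖A - 1‖ * ‖X‖ := by
  refine (pi_norm_le_iff_of_nonneg (by positivity)).2 fun b => ?_
  calc ‖((fun b => A b * X b) - X) b‖ = ‖(A - 1) b * X b‖ := by simp only [Pi.sub_apply, Pi.one_apply, sub_mul, one_mul]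
    _ ≤ ‖(A - 1) b‖ * ‖X b‖ := norm_mul_le _ _
    _ ≤ ‖A - 1‖ * ‖X‖ := mul_le_mul (norm_le_pi_norm _ b) (norm_le_pi_norm _ b) (norm_nonneg _) (norm_nonneg _)

/-- An elementary algebraic identity behind the three-term split: `W*·a − q = (W* − 1)·a + (a − a′) + (a′ − q)`. [folklore] -/
theorem star_mul_sub_eq_three_terms (W a a' q : Matrix (Fin N) (Fin N) ℂ) : star W * a - q = (star W - 1) * a + (a - a') + (a' - q) := by
  noncomm_ring

/-- Uniformising per-level constants over the levels `j ≤ k` (plain induction; `max` of the `K`'s, `min` of the `ρ`'s), for any predicate monotone in `(K↑, ρ↓)`. [folklore] -/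
theorem exists_uniform_of_forall_level (p : ℕ → ℝ → ℝ → Prop)
    (hmono : ∀ j K K' ρ ρ', K ≤ K' → ρ' ≤ ρ → p j K ρ → p j K' ρ')
    (h : ∀ j, ∃ K ρ : ℝ, 0 ≤ K ∧ 0 < ρ ∧ p j K ρ) :
    ∀ k : ℕ, ∃ K ρ : ℝ, 0 ≤ K ∧ 0 < ρ ∧ ∀ j, j ≤ k → p j K ρ
  | 0 => by
    obtain ⟨K, ρ, hK, hρ, hp⟩ := h 0
    refine ⟨K, ρ, hK, hρ, fun j hj => ?_⟩
    obtain rfl := Nat.le_zero.1 hj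
    exact hp
  | k + 1 => by
    obtain ⟨K, ρ, hK, hρ, hp⟩ := exists_uniform_of_forall_level p hmono h k
    obtain ⟨K₁, ρ₁, -, hρ₁, hp₁⟩ := h (k + 1)
    refine ⟨max K K₁, min ρ ρ₁, le_max_of_le_left hK, lt_min hρ hρ₁, fun j hj => ?_⟩
    rcases Nat.lt_or_eq_of_le hj with hlt | rfl
    · exact hmono j K _ ρ _ (le_max_left _ _) (min_le_left _ _) (hp j (Nat.lt_succ_iff.1 hlt))
    · exact hmono _ K₁ _ ρ₁ _ (le_max_right _ _) (min_le_right _ _) hp₁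

/-- The `↑U_b − 1` twist at a configuration: `‖(b ↦ ↑U_b·X_b) − X‖ ≤ ‖↑U − 1‖·‖X‖`. [cite: Balaban1985Variational, (44)-(48) p.285 (bookkeeping)] -/
theorem norm_coeMul_sub_le (U : GaugeField P 0 (SU N)) (X : PBond P 0 → Matrix (Fin N) (Fin N) ℂ) :
    ‖(fun b => (U b : Matrix (Fin N) (Fin N) ℂ) * X b) - X‖ ≤ ‖coeField U - 1‖ * ‖X‖ :=
  norm_mulLeft_sub_le (coeField U) X

/-- The multiplied direction is controlled: `‖b ↦ ↑U_b·X_b‖ ≤ (1 + ‖↑U − 1‖)·‖X‖`. [cite: Balaban1985Variational, (44)-(48) p.285 (bookkeeping)] -/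
theorem norm_coeMul_le (U : GaugeField P 0 (SU N)) (X : PBond P 0 → Matrix (Fin N) (Fin N) ℂ) :
    ‖(fun b => (U b : Matrix (Fin N) (Fin N) ℂ) * X b)‖ ≤ (1 + ‖coeField U - 1‖) * ‖X‖ := by
  have h := norm_coeMul_sub_le U X
  have hins := norm_le_insert' (fun b => (U b : Matrix (Fin N) (Fin N) ℂ) * X b) X
  nlinarith [norm_nonneg X]

/-- **`π = suProj` is bounded**: `‖π(v)‖ ≤ c·‖v‖` for some `c ≥ 0` (a continuous linear map between normed spaces is bounded; stated without the operator norm). [cite: Balaban1985Averaging, (17)-(19) p.21 (bookkeeping)] -/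
theorem exists_norm_suProj_le : ∃ c : ℝ, 0 ≤ c ∧ ∀ v : Matrix (Fin N) (Fin N) ℂ, ‖suProj N v‖ ≤ c * ‖v‖ := by
  obtain ⟨c, hc, h⟩ := SemilinearMapClass.bound_of_continuous (suProj N) (suProj N).continuous
  exact ⟨c, hc.le, h⟩
end Generic

/-! ## §0  PRIVATE COPIES of module C's letters (`…N12GuardedChartDerivIterLin`, p596651 ✓; cite its PUBLIC originals) and §1b–§2 on a generic torus -/

section Torus

variable {P : Params} {N : ℕ} [NeZero N]

/-- (module C, private copy) a threshold with `stokesConst·t₀ < δ_N`. [cite: Balaban1987RG1, (0.4) p.253 (bookkeeping)] -/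
private theorem exists_stokesThreshold : ∃ t₀ : ℝ, 0 < t₀ ∧ stokesConst P * t₀ < deltaSU (Fin N) := by
  refine ⟨deltaSU (Fin N) / (2 * (stokesConst P + 1)), by have := deltaSU_pos (n := Fin N); have := stokesConst_nonneg P; positivity, ?_⟩
  have hδ := deltaSU_pos (n := Fin N)
  have hs := stokesConst_nonneg P
  rw [mul_div_assoc']
  rw [div_lt_iff₀ (by positivity)]
  nlinarith

/-- (module C, private copy) the (0.4) family fixes the flat configuration. [cite: Balaban1987RG1, (0.4) p.253 (bookkeeping)] -/
private theorem iter_one : ∀ k : ℕ,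
    Averaging.iter (fun i => blockAvg (P := P) (j := i) (expMeanLogSU (n := Fin N))) k (1 : GaugeField P 0 (SU N)) = 1
  | 0 => rfl
  | k + 1 => by
    show (blockAvg expMeanLogSU).avg (Averaging.iter (fun i => blockAvg (P := P) (j := i) (expMeanLogSU (n := Fin N))) k 1) = 1
    rw [iter_one k, BlockAveraging.blockAvg_avg]
    exact T3DescentFibreTower.avgFun_one _ T3DescentFibreTower.expMeanLogSU_E_one

/-- (module C, private copy) the flat iterates are `t₀`-small. [cite: Balaban1987RG1, (0.4) p.253 (bookkeeping)] -/
private theorem plaqSmall_iter_one {t₀ : ℝ} (ht₀ : 0 < t₀) (i : ℕ) :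
    PlaqSmall t₀ (Averaging.iter (fun i => blockAvg (P := P) (j := i) (expMeanLogSU (n := Fin N))) i (1 : GaugeField P 0 (SU N))) := by
  rw [iter_one]
  exact T3DescentFibreTower.plaqSmall_one ht₀

/-- (module C, private copy) the flat configuration is on the guard below every level. [cite: Balaban1987RG1, (0.4) p.253 (bookkeeping)] -/
private theorem smallBelow_one (k : ℕ) : SmallBelow (fun i => blockAvg (P := P) (j := i) (expMeanLogSU (n := Fin N))) k (1 : GaugeField P 0 (SU N)) := by
  obtain ⟨t₀, ht₀, hst⟩ := exists_stokesThreshold (P := P) (N := N)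
  exact smallBelow_of_plaqSmall ht₀ hst fun i _ => plaqSmall_iter_one ht₀ i

/-- (module C, private copy) `↑1 = 1`. [folklore] -/
private theorem coeField_one : coeField (1 : GaugeField P 0 (SU N)) = 1 := by
  funext b; rfl

/-- (module C §1, private copy) `fderiv ℝ (iterM k) ↑1 ↑X = Q^{(k)}↑X` on `𝔰𝔲(N)`-directions. [cite: Balaban1985Averaging, Prop. 3 (121)-(125) p.36; Balaban1987RG1, (0.21) p.256] -/
private theorem fderiv_iterM_one_apply_eq_iterLin
    (Q : (i : ℕ) → (PBond P 0 → Matrix (Fin N) (Fin N) ℂ) → PBond P i → Matrix (Fin N) (Fin N) ℂ)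
    (hQ0 : ∀ Y, Q 0 Y = Y) (hQs : ∀ (i : ℕ) (Y : PBond P 0 → Matrix (Fin N) (Fin N) ℂ) (c : PBond P (i + 1)), Q (i + 1) Y c = linAvg (Q i Y) c)
    (k : ℕ) (X : PBond P 0 → lieSU (Fin N)) :
    fderiv ℝ (iterM k) (coeField (1 : GaugeField P 0 (SU N)))
        (fun b => (X b : Matrix (Fin N) (Fin N) ℂ))
      = Q k (fun b => (X b : Matrix (Fin N) (Fin N) ℂ)) := by
  obtain ⟨t₀, ht₀, hst⟩ := exists_stokesThreshold (P := P) (N := N)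
  have hΓ : HasDerivAt (fun t : ℝ => coeField (expChart (1 : GaugeField P 0 (SU N)) (t • X))) (fun b => (X b : Matrix (Fin N) (Fin N) ℂ)) 0 :=
    hasDerivAt_pi.2 fun b => hasDerivAt_coe_expChart_one_smul X b
  have h1 := hasDerivAt_coeField_iter (k := k) ht₀ hst hΓ (fun i _ => by
    rw [zero_smul, expChart_zero]; exact plaqSmall_iter_one ht₀ i)
  have h2 : HasDerivAt (fun t : ℝ => coeField (Averaging.iter (fun i => blockAvg (P := P) (j := i) (expMeanLogSU (n := Fin N))) k
      (expChart (1 : GaugeField P 0 (SU N)) (t • X))))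
      (fun c => Q k (fun b => (X b : Matrix (Fin N) (Fin N) ℂ)) c) 0 :=
    hasDerivAt_pi.2 fun c => hasDerivAt_coe_iter_expChart_one_smul Q hQ0 hQs X k c
  have h := h1.unique h2
  rw [zero_smul, expChart_zero] at h
  exact h
/-! ### §1b  Letters near the flat configuration -/

/-- **The operator-norm Lipschitz letter**: `‖D(Ū^k)(↑U) − D(Ū^k)(↑1)‖ ≤ K·‖↑U − 1‖` whenever `‖↑U − 1‖ < ρ` (C^∞ at `↑1` ⇒ C¹ derivative ⇒ Lipschitz on a ball). [cite: Balaban1985Averaging, Prop. 3 (121)-(125) p.36; Balaban1987RG1, (0.21) p.256] -/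
theorem exists_norm_fderiv_iterM_sub_fderiv_one_le (k : ℕ) :
    ∃ K ρ : ℝ, 0 ≤ K ∧ 0 < ρ ∧ ∀ U : GaugeField P 0 (SU N), ‖coeField U - 1‖ < ρ →
      ‖fderiv ℝ (iterM k) (coeField U) - fderiv ℝ (iterM k) (coeField (1 : GaugeField P 0 (SU N)))‖
        ≤ K * ‖coeField U - 1‖ := by
  have hC : ContDiffAt ℝ ⊤ (iterM k) (coeField (1 : GaugeField P 0 (SU N))) := contDiffAt_iterM k (smallBelow_one k)
  have hD : ContDiffAt ℝ 1 (fderiv ℝ (iterM k)) (coeField (1 : GaugeField P 0 (SU N))) := hC.fderiv_right le_top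
  obtain ⟨K, t, ht, hLip⟩ := hD.exists_lipschitzOnWith
  obtain ⟨ρ, hρ, hball⟩ := Metric.mem_nhds_iff.1 ht
  refine ⟨K, ρ, K.2, hρ, fun U hU => ?_⟩
  have h1 : coeField (1 : GaugeField P 0 (SU N)) ∈ t := hball (Metric.mem_ball_self hρ)
  have hU' : coeField U ∈ t := hball (by rw [Metric.mem_ball, dist_eq_norm, coeField_one]; exact hU)
  have hdist := hLip.dist_le_mul _ hU' _ h1
  rw [dist_eq_norm, dist_eq_norm] at hdist
  calc _ ≤ (K : ℝ) * ‖coeField U - coeField (1 : GaugeField P 0 (SU N))‖ := hdist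
    _ = K * ‖coeField U - 1‖ := by rw [coeField_one]

/-- (module C §2 = (C2), private copy, here read through §1's Lipschitz letter) `‖D(Ū^k)(↑U)↑X − Q^{(k)}↑X‖ ≤ K‖↑U − 1‖‖↑X‖` for `‖↑U − 1‖ < ρ`. [cite: Balaban1985Averaging, Prop. 3 (121)-(125) p.36] -/
private theorem exists_norm_fderiv_iterM_sub_iterLin_le
    (Q : (i : ℕ) → (PBond P 0 → Matrix (Fin N) (Fin N) ℂ) → PBond P i → Matrix (Fin N) (Fin N) ℂ)
    (hQ0 : ∀ Y, Q 0 Y = Y) (hQs : ∀ (i : ℕ) (Y : PBond P 0 → Matrix (Fin N) (Fin N) ℂ) (c : PBond P (i + 1)), Q (i + 1) Y c = linAvg (Q i Y) c)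
    (k : ℕ) :
    ∃ K ρ : ℝ, 0 ≤ K ∧ 0 < ρ ∧ ∀ U : GaugeField P 0 (SU N), ‖coeField U - 1‖ < ρ → ∀ X : PBond P 0 → lieSU (Fin N),
      ‖fderiv ℝ (iterM k) (coeField U) (fun b => (X b : Matrix (Fin N) (Fin N) ℂ)) - Q k (fun b => (X b : Matrix (Fin N) (Fin N) ℂ))‖
        ≤ K * ‖coeField U - 1‖ * ‖(fun b => (X b : Matrix (Fin N) (Fin N) ℂ))‖ := by
  obtain ⟨K, ρ, hK, hρ, h⟩ := exists_norm_fderiv_iterM_sub_fderiv_one_le (P := P) (N := N) k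
  refine ⟨K, ρ, hK, hρ, fun U hU X => ?_⟩
  have happ : fderiv ℝ (iterM k) (coeField U) (fun b => (X b : Matrix (Fin N) (Fin N) ℂ)) - Q k (fun b => (X b : Matrix (Fin N) (Fin N) ℂ))
      = (fderiv ℝ (iterM k) (coeField U) - fderiv ℝ (iterM k) (coeField (1 : GaugeField P 0 (SU N)))) (fun b => (X b : Matrix (Fin N) (Fin N) ℂ)) := by
    rw [show ∀ (A B : (PBond P 0 → Matrix (Fin N) (Fin N) ℂ) →L[ℝ] (PBond P k → Matrix (Fin N) (Fin N) ℂ)) (v : PBond P 0 → Matrix (Fin N) (Fin N) ℂ),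
      (A - B) v = A v - B v from fun A B v => rfl, fderiv_iterM_one_apply_eq_iterLin Q hQ0 hQs k X]
  rw [happ]
  exact (ContinuousLinearMap.le_opNorm _ _).trans (mul_le_mul_of_nonneg_right (h U hU) (norm_nonneg _))

/-- (module C §2, private copy) `‖iterM k ↑U − 1‖ ≤ K‖↑U − 1‖` for `‖↑U − 1‖ < ρ`. [cite: Balaban1987RG1, (0.4) p.253, (0.21) p.256] -/
private theorem exists_norm_iterM_sub_one_le (k : ℕ) :
    ∃ K ρ : ℝ, 0 ≤ K ∧ 0 < ρ ∧ ∀ U : GaugeField P 0 (SU N), ‖coeField U - 1‖ < ρ →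
      ‖(iterM k) (coeField U) - 1‖ ≤ K * ‖coeField U - 1‖ := by
  have hC : ContDiffAt ℝ 1 (iterM k) (coeField (1 : GaugeField P 0 (SU N))) := (contDiffAt_iterM k (smallBelow_one k)).of_le le_top
  obtain ⟨K, t, ht, hLip⟩ := hC.exists_lipschitzOnWith
  obtain ⟨ρ, hρ, hball⟩ := Metric.mem_nhds_iff.1 ht
  refine ⟨K, ρ, K.2, hρ, fun U hU => ?_⟩
  have h1 : coeField (1 : GaugeField P 0 (SU N)) ∈ t := hball (Metric.mem_ball_self hρ)
  have hU' : coeField U ∈ t := hball (by rw [Metric.mem_ball, dist_eq_norm, coeField_one]; exact hU)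
  have hdist := hLip.dist_le_mul _ hU' _ h1
  rw [dist_eq_norm, dist_eq_norm] at hdist
  have hone : (iterM k) (coeField (1 : GaugeField P 0 (SU N))) = 1 := by
    rw [← coeField_iter_eq_iterM k (smallBelow_one k), iter_one]
    funext c; rfl
  rw [hone, coeField_one] at hdist
  exact hdist

/-- **The derivative stays bounded near the flat configuration**: `‖D(Ū^k)(↑U)‖ ≤ B` whenever `‖↑U − 1‖ < ρ` (`B = ‖D(Ū^k)(↑1)‖ + Kρ`). [cite: Balaban1985Averaging, Prop. 3 (124)-(125) p.36] -/
theorem exists_norm_fderiv_iterM_le (k : ℕ) :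
    ∃ B ρ : ℝ, 0 ≤ B ∧ 0 < ρ ∧ ∀ U : GaugeField P 0 (SU N), ‖coeField U - 1‖ < ρ →
      ‖fderiv ℝ (iterM k) (coeField U)‖ ≤ B := by
  obtain ⟨K, ρ, hK, hρ, h⟩ := exists_norm_fderiv_iterM_sub_fderiv_one_le (P := P) (N := N) k
  refine ⟨‖fderiv ℝ (iterM k) (coeField (1 : GaugeField P 0 (SU N)))‖ + K * ρ,
    ρ, by positivity, hρ, fun U hU => ?_⟩
  have hsub := h U hU
  have hins := norm_le_insert'
    (fderiv ℝ (iterM k) (coeField U))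
    (fderiv ℝ (iterM k) (coeField (1 : GaugeField P 0 (SU N))))
  nlinarith [norm_nonneg (coeField U - 1)]

/-- **ONE PAIR OF CONSTANTS PER LEVEL** serving (C2), the derivative bound `‖D(Ū^j)(↑U)‖ ≤ K` and `‖iterM j ↑U − 1‖ ≤ K‖↑U − 1‖`, for `‖↑U − 1‖ < ρ`. [cite: Balaban1985Averaging, Prop. 3 (121)-(125) p.36; Balaban1987RG1, (0.21) p.256] -/
theorem exists_levelLetters
    (Q : (i : ℕ) → (PBond P 0 → Matrix (Fin N) (Fin N) ℂ) → PBond P i → Matrix (Fin N) (Fin N) ℂ)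
    (hQ0 : ∀ Y, Q 0 Y = Y) (hQs : ∀ (i : ℕ) (Y : PBond P 0 → Matrix (Fin N) (Fin N) ℂ) (c : PBond P (i + 1)), Q (i + 1) Y c = linAvg (Q i Y) c)
    (j : ℕ) :
    ∃ K ρ : ℝ, 0 ≤ K ∧ 0 < ρ ∧ ∀ U : GaugeField P 0 (SU N), ‖coeField U - 1‖ < ρ →
      ‖fderiv ℝ (iterM j) (coeField U)‖ ≤ K ∧
      ‖(iterM j) (coeField U) - 1‖ ≤ K * ‖coeField U - 1‖ ∧
      ∀ X : PBond P 0 → lieSU (Fin N),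
        ‖fderiv ℝ (iterM j) (coeField U) (fun b => (X b : Matrix (Fin N) (Fin N) ℂ)) - Q j (fun b => (X b : Matrix (Fin N) (Fin N) ℂ))‖
          ≤ K * ‖coeField U - 1‖ * ‖(fun b => (X b : Matrix (Fin N) (Fin N) ℂ))‖ := by
  obtain ⟨K₁, ρ₁, hK₁, hρ₁, h₁⟩ := exists_norm_fderiv_iterM_le (P := P) (N := N) j
  obtain ⟨K₂, ρ₂, hK₂, hρ₂, h₂⟩ := exists_norm_iterM_sub_one_le (P := P) (N := N) j
  obtain ⟨K₃, ρ₃, hK₃, hρ₃, h₃⟩ := exists_norm_fderiv_iterM_sub_iterLin_le Q hQ0 hQs j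
  refine ⟨K₁ + K₂ + K₃, min ρ₁ (min ρ₂ ρ₃), by positivity, lt_min hρ₁ (lt_min hρ₂ hρ₃), fun U hU => ⟨?_, ?_, fun X => ?_⟩⟩
  · have := h₁ U (lt_of_lt_of_le hU (min_le_left _ _)); linarith
  · have := h₂ U (lt_of_lt_of_le hU ((min_le_right _ _).trans (min_le_left _ _)))
    nlinarith [norm_nonneg (coeField U - 1)]
  · have := h₃ U (lt_of_lt_of_le hU ((min_le_right _ _).trans (min_le_right _ _))) X
    nlinarith [norm_nonneg (coeField U - 1), norm_nonneg (fun b => (X b : Matrix (Fin N) (Fin N) ℂ)),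
      mul_nonneg (norm_nonneg (coeField U - 1)) (norm_nonneg (fun b => (X b : Matrix (Fin N) (Fin N) ℂ)))]

/-- **ONE PAIR OF CONSTANTS FOR ALL LEVELS `j ≤ k`** serving the three letters of `exists_levelLetters`. [cite: Balaban1985Averaging, Prop. 3 (121)-(125) p.36; Balaban1987RG1, (0.21) p.256] -/
theorem exists_levelLetters_uniform
    (Q : (i : ℕ) → (PBond P 0 → Matrix (Fin N) (Fin N) ℂ) → PBond P i → Matrix (Fin N) (Fin N) ℂ)
    (hQ0 : ∀ Y, Q 0 Y = Y) (hQs : ∀ (i : ℕ) (Y : PBond P 0 → Matrix (Fin N) (Fin N) ℂ) (c : PBond P (i + 1)), Q (i + 1) Y c = linAvg (Q i Y) c)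
    (k : ℕ) :
    ∃ K ρ : ℝ, 0 ≤ K ∧ 0 < ρ ∧ ∀ j, j ≤ k → ∀ U : GaugeField P 0 (SU N), ‖coeField U - 1‖ < ρ →
      ‖fderiv ℝ (iterM j) (coeField U)‖ ≤ K ∧
      ‖(iterM j) (coeField U) - 1‖ ≤ K * ‖coeField U - 1‖ ∧
      ∀ X : PBond P 0 → lieSU (Fin N),
        ‖fderiv ℝ (iterM j) (coeField U) (fun b => (X b : Matrix (Fin N) (Fin N) ℂ)) - Q j (fun b => (X b : Matrix (Fin N) (Fin N) ℂ))‖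
          ≤ K * ‖coeField U - 1‖ * ‖(fun b => (X b : Matrix (Fin N) (Fin N) ℂ))‖ := by
  refine exists_uniform_of_forall_level _ (fun j K K' ρ ρ' hK hρ hp U hU => ?_) (exists_levelLetters Q hQ0 hQs) k
  obtain ⟨h1, h2, h3⟩ := hp U (lt_of_lt_of_le hU hρ)
  refine ⟨h1.trans hK, h2.trans (mul_le_mul_of_nonneg_right hK (norm_nonneg _)), fun X => (h3 X).trans ?_⟩
  exact mul_le_mul_of_nonneg_right (mul_le_mul_of_nonneg_right hK (norm_nonneg _)) (norm_nonneg _)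

/-! ### §2  The left-trivialised linearisation against `Q^{(j)}` — guard-free, chart-free -/

/-- ★★ **THE CORE ESTIMATE (guard-free, chart-free)**: `∃ C ρ` (depending on the torus, `N`, `k`, `Q` only) with, for all `j ≤ k`, `‖↑U − 1‖ < ρ`, `X : bonds → 𝔰𝔲(N)`, coarse bonds `c`:
`‖(iterM j ↑U)(c)* · (D(Ū^j)(↑U)[b ↦ ↑U_b·↑X_b])(c) − (Q^{(j)}↑X)(c)‖ ≤ C·‖↑U − 1‖·‖↑X‖` (`D(Ū^j)(↑U) = fderiv ℝ (iterM j) ↑U` = n07-w1's `dIterL j ↑U`, the left entry = `qLin j U X c`,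
both by `rfl`); split `W*·a − q = (W* − 1)·a + (a − a′) + (a′ − q)`, `a = D_U(U·X)(c)`, `a′ = D_U(X)(c)`. [cite: Balaban1985Averaging, Prop. 3 (121)-(125) p.36; Balaban1985Variational, (44)-(48) p.285; Balaban1987RG1, (0.21) p.256] -/
theorem exists_norm_leftTriv_fderiv_iterM_sub_iterLin_le
    (Q : (i : ℕ) → (PBond P 0 → Matrix (Fin N) (Fin N) ℂ) → PBond P i → Matrix (Fin N) (Fin N) ℂ)
    (hQ0 : ∀ Y, Q 0 Y = Y) (hQs : ∀ (i : ℕ) (Y : PBond P 0 → Matrix (Fin N) (Fin N) ℂ) (c : PBond P (i + 1)), Q (i + 1) Y c = linAvg (Q i Y) c)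
    (k : ℕ) :
    ∃ C ρ : ℝ, 0 ≤ C ∧ 0 < ρ ∧ ∀ j, j ≤ k → ∀ U : GaugeField P 0 (SU N), ‖coeField U - 1‖ < ρ →
      ∀ (X : PBond P 0 → lieSU (Fin N)) (c : PBond P j),
        ‖star ((iterM j) (coeField U) c) *
              fderiv ℝ (iterM j) (coeField U) (fun b => (U b : Matrix (Fin N) (Fin N) ℂ) * (X b : Matrix (Fin N) (Fin N) ℂ)) c
            - Q j (fun b => (X b : Matrix (Fin N) (Fin N) ℂ)) c‖
          ≤ C * ‖coeField U - 1‖ * ‖(fun b => (X b : Matrix (Fin N) (Fin N) ℂ))‖ := by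
  obtain ⟨K₀, ρ, hK₀, hρ, hlev⟩ := exists_levelLetters_uniform Q hQ0 hQs k
  refine ⟨K₀ * K₀ * (1 + ρ) + K₀ + K₀, ρ, by positivity, hρ, fun j hj U hU X c => ?_⟩
  obtain ⟨hD, hW, hC2⟩ := hlev j hj U hU
  set Xm : PBond P 0 → Matrix (Fin N) (Fin N) ℂ := fun b => (X b : Matrix (Fin N) (Fin N) ℂ) with hXm
  set UX : PBond P 0 → Matrix (Fin N) (Fin N) ℂ := fun b => (U b : Matrix (Fin N) (Fin N) ℂ) * (X b : Matrix (Fin N) (Fin N) ℂ) with hUX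
  set D := fderiv ℝ (iterM j) (coeField U) with hDdef
  set Wm : Matrix (Fin N) (Fin N) ℂ := (iterM j) (coeField U) c with hWm
  have hUX_sub : ‖UX - Xm‖ ≤ ‖coeField U - 1‖ * ‖Xm‖ := norm_coeMul_sub_le U Xm
  have hUX_le : ‖UX‖ ≤ (1 + ‖coeField U - 1‖) * ‖Xm‖ := norm_coeMul_le U Xm
  have hW1 : ‖star Wm - 1‖ ≤ K₀ * ‖coeField U - 1‖ := by
    rw [norm_star_sub_one, hWm]
    exact (norm_le_pi_norm ((iterM j) (coeField U) - 1) c).trans hW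
  have hT1 : ‖(star Wm - 1) * D UX c‖ ≤ K₀ * ‖coeField U - 1‖ * (K₀ * ((1 + ρ) * ‖Xm‖)) := by
    refine (norm_mul_le _ _).trans (mul_le_mul hW1 ?_ (norm_nonneg _) (by positivity))
    calc ‖D UX c‖ ≤ ‖D UX‖ := norm_le_pi_norm _ _
      _ ≤ ‖D‖ * ‖UX‖ := D.le_opNorm UX
      _ ≤ K₀ * ((1 + ρ) * ‖Xm‖) := mul_le_mul hD (hUX_le.trans (by nlinarith [norm_nonneg Xm, norm_nonneg (coeField U - 1)])) (norm_nonneg _) hK₀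
  have hT2 : ‖D UX c - D Xm c‖ ≤ K₀ * (‖coeField U - 1‖ * ‖Xm‖) := by
    rw [← Pi.sub_apply, ← map_sub]
    calc ‖D (UX - Xm) c‖ ≤ ‖D (UX - Xm)‖ := norm_le_pi_norm _ _
      _ ≤ ‖D‖ * ‖UX - Xm‖ := D.le_opNorm _
      _ ≤ K₀ * (‖coeField U - 1‖ * ‖Xm‖) := mul_le_mul hD hUX_sub (norm_nonneg _) hK₀
  have hT3 : ‖D Xm c - Q j Xm c‖ ≤ K₀ * ‖coeField U - 1‖ * ‖Xm‖ := by
    rw [← Pi.sub_apply]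
    exact (norm_le_pi_norm (D Xm - Q j Xm) c).trans (hC2 X)
  rw [star_mul_sub_eq_three_terms Wm (D UX c) (D Xm c) (Q j Xm c)]
  refine ((norm_add_le _ _).trans (add_le_add (norm_add_le _ _) le_rfl)).trans ?_
  refine (add_le_add (add_le_add hT1 hT2) hT3).trans (le_of_eq ?_)
  ring
end Torus

/-! ## §3  At NODE 00's objects: the `(δ₂)` letter at the chart level -/

section Guarded

variable {F : T4Family} {N : ℕ} [NeZero N] {K k : ℕ}

/-- (module C §3, private copy) `(DΦ_U(0)X)_{(j,c)} = π((M˙U)_j(c)*·(D(Ū^j)(↑U)(↑U·↑X))(c))` on 35e's guard. [cite: Balaban1985Variational, (44)-(48) p.285, (83) p.290; Balaban1987RG1, (0.21) p.256] -/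
private theorem fderiv_msChart_apply_eq_of_plaqSmall {t₀ : ℝ} (ht₀ : 0 < t₀) (hstδ : stokesConst (F.P K) * t₀ < deltaSU (Fin N))
    {U : GaugeField (F.P K) 0 (SU N)} (hsm : ∀ i, i < k → PlaqSmall t₀ (Averaging.iter (avOfRecord F N K) i U))
    (𝔹 : DetSet (F.P K)) (X : PBond (F.P K) 0 → lieSU (Fin N)) (i : Fin (constrCard 𝔹 k)) :
    fderiv ℝ (msChart F N K k 𝔹 (avgFamily (avOfRecord F N K) U) U) 0 X i
      = suProj N (star ((avgFamily (avOfRecord F N K) U ((constrEnum 𝔹 k).symm i).1 ((constrEnum 𝔹 k).symm i).2.1 : SU N) : Matrix (Fin N) (Fin N) ℂ) *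
          fderiv ℝ (iterM (((constrEnum 𝔹 k).symm i).1 : ℕ))
            (coeField U) (fun b => (U b : Matrix (Fin N) (Fin N) ℂ) * (X b : Matrix (Fin N) (Fin N) ℂ)) ((constrEnum 𝔹 k).symm i).2.1) := by
  set s := (constrEnum 𝔹 k).symm i with hs
  have hj : (s.1 : ℕ) ≤ k := Nat.lt_succ_iff.1 s.1.2
  have hΓ : HasDerivAt (fun t : ℝ => coeField (expChart U (t • X))) (fun b => (U b : Matrix (Fin N) (Fin N) ℂ) * (X b : Matrix (Fin N) (Fin N) ℂ)) 0 :=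
    hasDerivAt_pi.2 fun b => hasDerivAt_coe_expChart_along (hasDerivAt_ray X) (zero_smul ℝ X) b
  have hsm' : ∀ i', i' < (s.1 : ℕ) → PlaqSmall t₀ (Averaging.iter (fun i => blockAvg (P := F.P K) (j := i) (expMeanLogSU (n := Fin N))) i' (expChart U ((0 : ℝ) • X))) :=
    fun i' hi' => by rw [zero_smul, expChart_zero]; exact hsm i' (lt_of_lt_of_le hi' hj)
  have hvel := hasDerivAt_coeField_iter (k := (s.1 : ℕ)) ht₀ hstδ hΓ hsm'
  have hvelc : HasDerivAt (fun t : ℝ => ((avgFamily (avOfRecord F N K) (expChart U (t • X)) s.1 s.2.1 : SU N) : Matrix (Fin N) (Fin N) ℂ))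
      (fderiv ℝ (iterM (s.1 : ℕ)) (coeField U) (fun b => (U b : Matrix (Fin N) (Fin N) ℂ) * (X b : Matrix (Fin N) (Fin N) ℂ)) s.2.1) 0 := by
    have h := (hasDerivAt_pi.1 hvel) s.2.1
    rw [zero_smul, expChart_zero] at h
    exact h
  have hsb : SmallBelow (avOfRecord F N K) k U := smallBelow_of_plaqSmall ht₀ hstδ hsm
  exact fderiv_msChart_apply_of_hasDerivAt (fun _ _ _ => rfl) hsb X i hvelc

/-- ★★★ **THE `(δ₂)` LETTER — THE CHART-LEVEL DEVIATION IS LINEAR IN `‖↑U − 1‖`**: `∃ C ρ` chosen BEFORE the configuration (depending on `F.P K`, `N`, `k`, `Q` only) such that for every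
`t₀ > 0` with `stokesConst·t₀ < δ_N`, every `U` on 35e's guard (`PlaqSmall t₀ (Ū^i U)`, `i < k`) with `‖↑U − 1‖ < ρ`, every level-bounded `𝔹`, direction `X` and constrained bond `i ↔ (j, c)`:
`‖(DΦ_U(0)X)_i − π((Q^{(j)}↑X)(c))‖ ≤ C·‖↑U − 1‖·‖↑X‖`, `Φ = msChart F N K k 𝔹 (M˙U) U` (module C §3 + `↑Ū^j(U)(c) = (iterM j ↑U)(c)` under the guard + §2 through the bound of `π`).
[cite: Balaban1985Averaging, Prop. 3 (121)-(125) p.36; Balaban1985Variational, (44)-(48) p.285, (83) p.290; Balaban1987RG1, (0.21) p.256] -/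
theorem exists_norm_fderiv_msChart_sub_suProj_iterLin_le
    (Q : (i : ℕ) → (PBond (F.P K) 0 → Matrix (Fin N) (Fin N) ℂ) → PBond (F.P K) i → Matrix (Fin N) (Fin N) ℂ)
    (hQ0 : ∀ Y, Q 0 Y = Y) (hQs : ∀ (i : ℕ) (Y : PBond (F.P K) 0 → Matrix (Fin N) (Fin N) ℂ) (c : PBond (F.P K) (i + 1)), Q (i + 1) Y c = linAvg (Q i Y) c) :
    ∃ C ρ : ℝ, 0 ≤ C ∧ 0 < ρ ∧ ∀ ⦃t₀ : ℝ⦄, 0 < t₀ → stokesConst (F.P K) * t₀ < deltaSU (Fin N) →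
      ∀ U : GaugeField (F.P K) 0 (SU N), (∀ i, i < k → PlaqSmall t₀ (Averaging.iter (avOfRecord F N K) i U)) → ‖coeField U - 1‖ < ρ →
      ∀ (𝔹 : DetSet (F.P K)) (X : PBond (F.P K) 0 → lieSU (Fin N)) (i : Fin (constrCard 𝔹 k)),
        ‖fderiv ℝ (msChart F N K k 𝔹 (avgFamily (avOfRecord F N K) U) U) 0 X i
            - suProj N (Q (((constrEnum 𝔹 k).symm i).1 : ℕ) (fun b => (X b : Matrix (Fin N) (Fin N) ℂ)) ((constrEnum 𝔹 k).symm i).2.1)‖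
          ≤ C * ‖coeField U - 1‖ * ‖(fun b => (X b : Matrix (Fin N) (Fin N) ℂ))‖ := by
  obtain ⟨C₀, ρ, hC₀, hρ, hcore⟩ := exists_norm_leftTriv_fderiv_iterM_sub_iterLin_le Q hQ0 hQs k
  obtain ⟨cπ, hcπ, hπ⟩ := exists_norm_suProj_le (N := N)
  refine ⟨cπ * C₀, ρ, by positivity, hρ, fun t₀ ht₀ hstδ U hsm hU 𝔹 X i => ?_⟩
  set s := (constrEnum 𝔹 k).symm i with hs
  have hj : (s.1 : ℕ) ≤ k := Nat.lt_succ_iff.1 s.1.2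
  have hchart := fderiv_msChart_apply_eq_of_plaqSmall ht₀ hstδ hsm 𝔹 X i
  have hsb : SmallBelow (avOfRecord F N K) (s.1 : ℕ) U := (smallBelow_of_plaqSmall ht₀ hstδ hsm).mono hj
  have hWeq : ((avgFamily (avOfRecord F N K) U s.1 s.2.1 : SU N) : Matrix (Fin N) (Fin N) ℂ)
      = (iterM (s.1 : ℕ)) (coeField U) s.2.1 := by
    have h := congrFun (coeField_avgFamily_eq_iterM (k := (s.1 : ℕ)) hsb) s.2.1
    rw [coeField_apply] at h
    exact h
  rw [hchart, ← map_sub, hWeq]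
  calc _ ≤ cπ * _ := hπ _
    _ ≤ cπ * (C₀ * ‖coeField U - 1‖ * ‖(fun b => (X b : Matrix (Fin N) (Fin N) ℂ))‖) :=
        mul_le_mul_of_nonneg_left (hcore (s.1 : ℕ) hj U hU X s.2.1) hcπ
    _ = cπ * C₀ * ‖coeField U - 1‖ * ‖(fun b => (X b : Matrix (Fin N) (Fin N) ℂ))‖ := by ring

/-- ★ **THE LANE WORD'S SHAPE — on the bondwise guard `∀ b, ‖↑U_b − 1‖ ≤ δ` (`0 ≤ δ < ρ`): `‖(DΦ_U(0)X)_i − π((Q^{(j)}↑X)(c))‖ ≤ C·δ·‖↑X‖`**, with `C, ρ` chosen before `U` and `δ`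
(LINEAR in `δ`, no hidden `δ`-dependence). [cite: Balaban1985Averaging, Prop. 3 (121)-(125) p.36; Balaban1985Variational, (44)-(48) p.285; Balaban1987RG1, (0.21) p.256] -/
theorem exists_norm_fderiv_msChart_sub_suProj_iterLin_le_of_forall_norm_sub_one_le
    (Q : (i : ℕ) → (PBond (F.P K) 0 → Matrix (Fin N) (Fin N) ℂ) → PBond (F.P K) i → Matrix (Fin N) (Fin N) ℂ)
    (hQ0 : ∀ Y, Q 0 Y = Y) (hQs : ∀ (i : ℕ) (Y : PBond (F.P K) 0 → Matrix (Fin N) (Fin N) ℂ) (c : PBond (F.P K) (i + 1)), Q (i + 1) Y c = linAvg (Q i Y) c) :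
    ∃ C ρ : ℝ, 0 ≤ C ∧ 0 < ρ ∧ ∀ ⦃t₀ : ℝ⦄, 0 < t₀ → stokesConst (F.P K) * t₀ < deltaSU (Fin N) →
      ∀ ⦃δ : ℝ⦄, 0 ≤ δ → δ < ρ →
      ∀ U : GaugeField (F.P K) 0 (SU N), (∀ i, i < k → PlaqSmall t₀ (Averaging.iter (avOfRecord F N K) i U)) →
        (∀ b, ‖(U b : Matrix (Fin N) (Fin N) ℂ) - 1‖ ≤ δ) →
      ∀ (𝔹 : DetSet (F.P K)) (X : PBond (F.P K) 0 → lieSU (Fin N)) (i : Fin (constrCard 𝔹 k)),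
        ‖fderiv ℝ (msChart F N K k 𝔹 (avgFamily (avOfRecord F N K) U) U) 0 X i
            - suProj N (Q (((constrEnum 𝔹 k).symm i).1 : ℕ) (fun b => (X b : Matrix (Fin N) (Fin N) ℂ)) ((constrEnum 𝔹 k).symm i).2.1)‖
          ≤ C * δ * ‖(fun b => (X b : Matrix (Fin N) (Fin N) ℂ))‖ := by
  obtain ⟨C, ρ, hC, hρ, h⟩ := exists_norm_fderiv_msChart_sub_suProj_iterLin_le (k := k) Q hQ0 hQs
  refine ⟨C, ρ, hC, hρ, fun t₀ ht₀ hstδ δ hδ hδρ U hsm hUb 𝔹 X i => ?_⟩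
  have hU : ‖coeField U - 1‖ ≤ δ := (pi_norm_le_iff_of_nonneg hδ).2 fun b => by
    rw [Pi.sub_apply, coeField_apply, Pi.one_apply]; exact hUb b
  exact (h ht₀ hstδ U hsm (lt_of_le_of_lt hU hδρ) 𝔹 X i).trans
    (mul_le_mul_of_nonneg_right (mul_le_mul_of_nonneg_left hU hC) (norm_nonneg _))
end Guarded

end Summit.QuantumFields.YangMills.BalabanUVNodes.N12GuardedChartDerivDeviation

end
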